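import Mathlib
import Summits.NavierStokesRegularity.NavierStokesRegularity.Theorems.EulerZoomLiouvillePowerGaugeEulerLiouvilleSelfSimilarTopBadNodeNoExit
import Summits.NavierStokesRegularity.NavierStokesRegularity.Theorems.EulerZoomLiouvillePowerGaugeEulerLiouvilleSelfSimilarNodalCone
import Summits.NavierStokesRegularity.NavierStokesRegularity.Theorems.EulerZoomLiouvillePowerGaugeEulerLiouvilleSelfSimilarTopBadNodeGraphData
import HarnessLib.Audit

/-!
# Rung C1 of the crux `EulerZoomLiouville.PowerGaugeEulerLiouville`: the NO-EXIT LEMMA — choice of the constants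
# (blueprint §3, `false_of_topBadNode_of_graph`)

Route №10 `EulerZoomLiouville`, crux E = stmt-NavierStokesRegularity-19832, rung C1; thirty-first file of the
NODAL-CONTINUUM line (ns-typeII-p1 g7).
* `false_of_topBadNode_of_graph` — **a degenerate top bad node carrying a kernel graph is impossible** (`0 < γ < ½`,
  `C²` profile with (3.8), `z` a non-vortical bad node adherent to `O = {curl U ≠ 0}` with `ℋ < ℋ(z)` on `O`, unit kernel
  vector `e` of `DV(z)`, global kernel-graph data `(g, φ)` as produced by `exists_kernelGraph_data`).  The proof CHOOSES
  the constants — accuracies `ν, ρ, η` → radii `δ`, `r` → side data `m` → `ε` — verifies the hypotheses of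
  `noExit_of_conditions`, and ends with the cone lemma `exists_thinRadius_of_badNode` (the trapped set would contain
  the nonempty open set `B(z, ε) ∩ O`).
WHAT THIS IS NOT: not NS, not E. [cite: ConstantinIgnatovaVicol2026Putative, §3.4.3–§3.5, §4] [cite: KatokHasselblatt1995, §6.2]
-/

noncomputable section
-- flat `Theorems/<Route><Decl>…` files of one crux share the namespace of the crux (tree convention)
set_option linter.dupNamespace false

open Set Filter Topology Metric Function InnerProductSpace
open scoped RealInnerProductSpace NNReal
namespace Summit.NavierStokesRegularity.NavierStokesRegularity.Theorems.PowerGaugeEulerLiouville.NodalContinuum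

open Literature.Analysis Literature.Analysis.FluidPDE Literature.Analysis.ODE
open Summit.NavierStokesRegularity.NavierStokesRegularity.Theorems.PowerGaugeEulerLiouville.NodalFiniteness
variable {γ C : ℝ} {c : EuclideanSpace ℝ (Fin 3)}
  {U : EuclideanSpace ℝ (Fin 3) → EuclideanSpace ℝ (Fin 3)} {P : EuclideanSpace ℝ (Fin 3) → ℝ}

set_option maxHeartbeats 6000000 in
/-- **The degenerate top bad node with a kernel graph is impossible** (no-exit lemma + cone lemma).  See the module
docstring. [cite: ConstantinIgnatovaVicol2026Putative, §3.4.3–§3.5, §4 (local analysis not in print)] [cite: KatokHasselblatt1995, §6.2 (cone criterion)] -/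
theorem false_of_topBadNode_of_graph (h : IsSelfSimilarEulerProfile γ c U P) (hγ : 0 < γ)
    (hγ2 : γ < 1 / 2) (hfar : HasSelfSimilarFarFieldWith γ c C U) {z : EuclideanSpace ℝ (Fin 3)}
    (hz : z ∈ selfSimilarNodalSet γ c U) (hΩz : curl U z = 0)
    (hbad : ∃ w : EuclideanSpace ℝ (Fin 3), ‖w‖ = 1 ∧ 1 ≤ ⟪fderiv ℝ U z w, w⟫)
    (hcl : z ∈ closure {y | curl U y ≠ 0})
    (hconf : ∀ x, curl U x ≠ 0 → selfSimilarBernoulli γ c U P x < selfSimilarBernoulli γ c U P z)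
    {e : EuclideanSpace ℝ (Fin 3)} (he1 : ‖e‖ = 1)
    (hAe : fderiv ℝ (selfSimilarTransport γ c U) z e = 0)
    {g g' : ℝ → EuclideanSpace ℝ (Fin 3)} {φ : ℝ → ℝ} {δg L C₁ : ℝ} (hδg : 0 < δg) (hL : 0 ≤ L) (hC₁ : 0 < C₁)
    (hg0 : g 0 = 0) (hge : ∀ τ, ⟪e, g τ⟫ = 0) (hgd : ∀ τ, HasDerivAt g (g' τ) τ)
    (hg' : ∀ τ, |τ| ≤ δg → ‖g' τ‖ ≤ L * |τ|)
    (hpar : ∀ τ, |τ| ≤ δg → selfSimilarTransport γ c U (z + τ • e + g τ) = φ τ • e)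
    (hφc : Continuous φ) (hφsq : ∀ τ, |τ| ≤ δg → |φ τ| ≤ C₁ * τ ^ 2)
    (hφlip : ∀ τ τ', |τ| ≤ δg → |τ'| ≤ δg → |φ τ - φ τ'| ≤ C₁ * δg * |τ - τ'|) : False := by
  classical
  set V := selfSimilarTransport γ c U with hV
  set A : EuclideanSpace ℝ (Fin 3) →L[ℝ] EuclideanSpace ℝ (Fin 3) := fderiv ℝ V z with hAdef
  set Hb := selfSimilarBernoulli γ c U P with hHb
  have h12 : 0 < 1 - 2 * γ := by linarith
  have hKlip := lipschitzWith_transport h hγ hfar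
  obtain ⟨b, a, μ, α, hb, hμ, hμα, hαge, hpos_i, hneg_i⟩ :=
    exists_spectralData_of_badNode h hγ hγ2 hΩz hbad he1 hAe
  have hα : 0 < α := lt_of_lt_of_le hμ hμα
  set K : ℝ := 2 * α / μ + 1 with hK
  have h0K : 0 ≤ 2 * α / μ := by positivity
  have hK1 : 1 ≤ K := (by rw [hK]; linarith); have hK2 : 2 ≤ 1 + K := (by linarith); have hK0 : 0 < 1 + K := by linarith
  obtain ⟨δ₀, hδ₀, hthin⟩ := exists_thinRadius_of_badNode h hγ2 hKlip hΩz hbad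
  set ν : ℝ := (1 - 2 * γ) * μ / 64 with hν
  have hνpos : 0 < ν := by positivity
  obtain ⟨δν, hδν, Cν, hCν, hexpν⟩ := selfSimilarBernoulli_expansion_offNode h hΩz hνpos
  obtain ⟨δ₁, hδ₁, hnode₁⟩ := selfSimilarBernoulli_expansion_of_curl_eq_zero h hz hΩz hνpos
  set C₃ : ℝ := (1 - 2 * γ) * ‖A‖ / 2 + ν with hC₃
  have hC₃0 : 0 ≤ C₃ := by positivity
  set τg : ℝ := (1 - 2 * γ) / (160 * C₁ * δg) with hτg
  have hτgpos : 0 < τg := by positivity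
  set Q₀ : ℝ := (1 - 2 * γ) * α / 2 + 2 * ν with hQ₀
  have hQ₀pos : 0 < Q₀ := by positivity
  set κ₁ : ℝ := min 1 (τg / (4 * Q₀ * (1 + K))) with hκ₁
  have hκ₁pos : 0 < κ₁ := by positivity
  have hκ₁1 : κ₁ ≤ 1 := min_le_left _ _; have hκ₁2 : κ₁ ≤ τg / (4 * Q₀ * (1 + K)) := min_le_right _ _
  set η : ℝ := min ((1 - 2 * γ) / 4) (min ((1 - 2 * γ) * μ * κ₁ / 32) (τg / (4 * (1 + K)))) with hη
  have hηpos : 0 < η := by positivity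
  have hη1 : η ≤ (1 - 2 * γ) / 4 := min_le_left _ _
  have hη2 : η ≤ (1 - 2 * γ) * μ * κ₁ / 32 := (min_le_right _ _).trans (min_le_left _ _)
  have hη3 : η ≤ τg / (4 * (1 + K)) := (min_le_right _ _).trans (min_le_right _ _)
  obtain ⟨δη, hδη, hηU⟩ := exists_DU_oscillation h z hηpos
  set ρ : ℝ := min (min μ 1 / (32 * (1 + K))) ((1 - 2 * γ) * μ ^ 3 * (3 * (1 + K)) / (32 * (C₃ + 1))) with hρ
  have hρpos : 0 < ρ := (by positivity); have hρa : ρ ≤ min μ 1 / (32 * (1 + K)) := min_le_left _ _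
  have hρb : ρ ≤ (1 - 2 * γ) * μ ^ 3 * (3 * (1 + K)) / (32 * (C₃ + 1)) := min_le_right _ _
  have hρμ : ρ ≤ μ / (32 * (1 + K)) := hρa.trans (div_le_div_of_nonneg_right (min_le_left _ _) (by positivity))
  have hρ1' : ρ ≤ 1 / (32 * (1 + K)) := hρa.trans (div_le_div_of_nonneg_right (min_le_right _ _) (by positivity))
  have hρle1 : ρ ≤ 1 := hρ1'.trans (by rw [div_le_one (by positivity)]; linarith)
  obtain ⟨δρ, hδρ, hlinρ⟩ := exists_ball_linearisation h z hρpos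
  set δ : ℝ := min (min δg (min δν δ₁)) (min δη δρ) with hδ
  have hδpos : 0 < δ := (by positivity); have hδg' : δ ≤ δg := (min_le_left _ _).trans (min_le_left _ _)
  have hδν' : δ ≤ δν := (min_le_left _ _).trans ((min_le_right _ _).trans (min_le_left _ _))
  have hδ₁' : δ ≤ δ₁ := (min_le_left _ _).trans ((min_le_right _ _).trans (min_le_right _ _))
  have hδη' : δ ≤ δη := (min_le_right _ _).trans (min_le_left _ _)
  have hδρ' : δ ≤ δρ := (min_le_right _ _).trans (min_le_right _ _)
  set C₁' : ℝ := C₁ * δg / δ with hC₁'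
  have hC₁'pos : 0 < C₁' := (by positivity); have hC₁'δ : C₁' * δ = C₁ * δg := by rw [hC₁']; field_simp
  have hC₁C₁' : C₁ ≤ C₁' := by
    rw [hC₁', le_div_iff₀ hδpos]; exact mul_le_mul_of_nonneg_left hδg' hC₁.le
  set r : ℝ := min (min (min (δ / 4) (δ₀ / 4)) (min 1 (1 / (4 * (L + 1)))))
    (min (min (μ * κ₁ / (8 * (1 + K) * (L + 1))) (μ / (8 * (L + 1))))
      (min (ν / (Cν * C₁' + 1)) (min (μ / (192 * ρ * (1 + K) * C₁')) (1 / (16 * (1 + K) * C₁'))))) with hr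
  have hrpos : 0 < r := (by positivity); have hrA : r ≤ min (min (δ / 4) (δ₀ / 4)) (min 1 (1 / (4 * (L + 1)))) := min_le_left _ _
  have hrB : r ≤ min (min (μ * κ₁ / (8 * (1 + K) * (L + 1))) (μ / (8 * (L + 1))))
      (min (ν / (Cν * C₁' + 1)) (min (μ / (192 * ρ * (1 + K) * C₁')) (1 / (16 * (1 + K) * C₁')))) :=
    min_le_right _ _
  have hr1 : r ≤ δ / 4 := hrA.trans ((min_le_left _ _).trans (min_le_left _ _))
  have hr2 : r ≤ δ₀ / 4 := hrA.trans ((min_le_left _ _).trans (min_le_right _ _))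
  have hr3 : r ≤ 1 := hrA.trans ((min_le_right _ _).trans (min_le_left _ _))
  have hr4 : r ≤ 1 / (4 * (L + 1)) := hrA.trans ((min_le_right _ _).trans (min_le_right _ _))
  have hr5 : r ≤ μ * κ₁ / (8 * (1 + K) * (L + 1)) := hrB.trans ((min_le_left _ _).trans (min_le_left _ _))
  have hr6 : r ≤ μ / (8 * (L + 1)) := hrB.trans ((min_le_left _ _).trans (min_le_right _ _))
  have hr7 : r ≤ ν / (Cν * C₁' + 1) := hrB.trans ((min_le_right _ _).trans (min_le_left _ _))
  have hr8 : r ≤ μ / (192 * ρ * (1 + K) * C₁') :=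
    hrB.trans ((min_le_right _ _).trans ((min_le_right _ _).trans (min_le_left _ _)))
  have hr9 : r ≤ 1 / (16 * (1 + K) * C₁') :=
    hrB.trans ((min_le_right _ _).trans ((min_le_right _ _).trans (min_le_right _ _)))
  have hrδ : 4 * r ≤ δ := by linarith
  have hLr : L * r ≤ 1 / 4 := by
    have h1 : L * r ≤ L * (1 / (4 * (L + 1))) := mul_le_mul_of_nonneg_left hr4 hL
    have h2 : L * (1 / (4 * (L + 1))) ≤ 1 / 4 := by
      rw [mul_one_div, div_le_div_iff₀ (by positivity) (by norm_num)]; nlinarith only [hL]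
    linarith
  set κ : ℝ := 512 * η ^ 2 / ((1 - 2 * γ) ^ 2 * μ ^ 2) + 16 * (1 + K) * (L * r) ^ 2 / μ ^ 2 with hκ
  have hκ0 : 0 ≤ κ := by positivity
  have hκη : 512 * η ^ 2 / ((1 - 2 * γ) ^ 2 * μ ^ 2) ≤ κ₁ / 2 := by
    have h1 : η ^ 2 ≤ ((1 - 2 * γ) * μ * κ₁ / 32) ^ 2 := pow_le_pow_left₀ hηpos.le hη2 2
    have h2 : κ₁ ^ 2 ≤ κ₁ := by nlinarith only [hκ₁1, hκ₁pos]
    have h2' := mul_le_mul_of_nonneg_left h2 (by positivity : (0:ℝ) ≤ (1 - 2 * γ) ^ 2 * μ ^ 2)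
    rw [div_le_iff₀ (by positivity)]
    linarith only [h1, h2']
  have hκr : 16 * (1 + K) * (L * r) ^ 2 / μ ^ 2 ≤ κ₁ / 2 := by
    have h1 : L * r ≤ L * (μ * κ₁ / (8 * (1 + K) * (L + 1))) := mul_le_mul_of_nonneg_left hr5 hL
    have h2 : L * (μ * κ₁ / (8 * (1 + K) * (L + 1))) ≤ μ * κ₁ / (8 * (1 + K)) := by
      rw [show L * (μ * κ₁ / (8 * (1 + K) * (L + 1))) = μ * κ₁ / (8 * (1 + K)) * (L / (L + 1)) by
        field_simp]
      exact mul_le_of_le_one_right (by positivity) (by rw [div_le_one (by linarith)]; linarith)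
    have h3 : L * r ≤ L * (μ / (8 * (L + 1))) := mul_le_mul_of_nonneg_left hr6 hL
    have h4 : L * (μ / (8 * (L + 1))) ≤ μ / 8 := by
      rw [show L * (μ / (8 * (L + 1))) = μ / 8 * (L / (L + 1)) by field_simp]
      exact mul_le_of_le_one_right (by positivity) (by rw [div_le_one (by linarith)]; linarith)
    have hLr0 : 0 ≤ L * r := by positivity
    have h5 : (L * r) ^ 2 ≤ (μ * κ₁ / (8 * (1 + K))) * (μ / 8) := by
      rw [sq]; exact mul_le_mul (h1.trans h2) (h3.trans h4) hLr0 (by positivity)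
    rw [div_le_iff₀ (by positivity)]
    have e1 : 16 * (1 + K) * ((μ * κ₁ / (8 * (1 + K))) * (μ / 8)) = κ₁ / 4 * μ ^ 2 := by field_simp; ring
    have h5' := mul_le_mul_of_nonneg_left h5 (by positivity : (0:ℝ) ≤ 16 * (1 + K))
    have : 0 ≤ κ₁ * μ ^ 2 := by positivity
    linarith only [h5', e1, this]
  have hκ1 : κ ≤ κ₁ := by rw [hκ]; linarith
  have hκle1 : κ ≤ 1 := hκ1.trans hκ₁1
  have hsqκ : Real.sqrt κ ≤ 1 := by rw [show (1:ℝ) = Real.sqrt 1 by simp]; exact Real.sqrt_le_sqrt hκle1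
  have hsq2K : Real.sqrt (2 * (1 + K)) ≤ 2 * (1 + K) := (Real.sqrt_le_left (by positivity)).2 (by nlinarith only [hK2])
  have hsqK : Real.sqrt (1 + K) ≤ 1 + K := (Real.sqrt_le_left (by positivity)).2 (by nlinarith only [hK2])
  have hsq2 : Real.sqrt 2 ≤ 2 := (Real.sqrt_le_left (by norm_num)).2 (by norm_num)
  have hsd : ∀ s : ℝ, ∃ ms : ℝ, 0 < ms ∧ ((∀ τ ∈ Icc (r / 4) (r / 2), φ (s * τ) = 0) ∨
      (∃ σ₀ ∈ Icc (r / 4) (r / 2), φ (s * σ₀) ≠ 0 ∧ |φ (s * σ₀)| = ms)) := by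
    intro s
    by_cases harc : ∀ τ ∈ Icc (r / 4) (r / 2), φ (s * τ) = 0
    · exact ⟨1, one_pos, Or.inl harc⟩
    · push Not at harc
      obtain ⟨σ₀, hσ₀, hne⟩ := harc
      exact ⟨|φ (s * σ₀)|, abs_pos.2 hne, Or.inr ⟨σ₀, hσ₀, hne, rfl⟩⟩
  choose ms hms using hsd
  set m : ℝ := min (ms 1) (ms (-1)) with hm; have hmpos : 0 < m := lt_min (hms 1).1 (hms (-1)).1
  have hm_le : ∀ s : ℝ, s * s = 1 → m ≤ ms s := by
    intro s hs
    rcases mul_self_eq_one_iff.1 hs with h1 | h1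
    · rw [h1]; exact min_le_left _ _
    · rw [h1]; exact min_le_right _ _
  set Q₁ : ℝ := (1 - 2 * γ) * α / 2 + ν + Cν * C₁' * r ^ 2 with hQ₁
  set B : ℝ := Q₁ * (18 * (1 + K) ^ 2) + 3 * (1 - 2 * γ) * C₁' / 2 + 3 * ρ ^ 2 * C₃ / μ ^ 2 with hB
  have hB0 : 0 ≤ B := by positivity
  set ε : ℝ := min (min (min (r / 8) 1) (min (μ * (3 * (1 + K)) / (16 * C₁')) (μ * r / (576 * ρ * (1 + K) ^ 2))))
    (min (min (r / (48 * (1 + K))) (m / (8 * C₁')))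
      (min (m / (96 * ρ * (1 + K) ^ 2))
        (min ((1 - 2 * γ) * m / (960 * (1 + K) ^ 2 * η * (C₁ * δg)))
          ((1 - 2 * γ) * m ^ 2 / (160 * (C₁ * δg) * (B + 1)))))) with hε
  have hεpos : 0 < ε := by positivity
  have hεA : ε ≤ min (min (r / 8) 1) (min (μ * (3 * (1 + K)) / (16 * C₁')) (μ * r / (576 * ρ * (1 + K) ^ 2))) :=
    min_le_left _ _
  have hεB : ε ≤ min (min (r / (48 * (1 + K))) (m / (8 * C₁')))
      (min (m / (96 * ρ * (1 + K) ^ 2))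
        (min ((1 - 2 * γ) * m / (960 * (1 + K) ^ 2 * η * (C₁ * δg)))
          ((1 - 2 * γ) * m ^ 2 / (160 * (C₁ * δg) * (B + 1))))) := min_le_right _ _
  have hε1 : ε ≤ r / 8 := hεA.trans ((min_le_left _ _).trans (min_le_left _ _))
  have hε2 : ε ≤ 1 := hεA.trans ((min_le_left _ _).trans (min_le_right _ _))
  have hε3 : ε ≤ μ * (3 * (1 + K)) / (16 * C₁') := hεA.trans ((min_le_right _ _).trans (min_le_left _ _))
  have hε4 : ε ≤ μ * r / (576 * ρ * (1 + K) ^ 2) := hεA.trans ((min_le_right _ _).trans (min_le_right _ _))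
  have hε5 : ε ≤ r / (48 * (1 + K)) := hεB.trans ((min_le_left _ _).trans (min_le_left _ _))
  have hε6 : ε ≤ m / (8 * C₁') := hεB.trans ((min_le_left _ _).trans (min_le_right _ _))
  have hε7 : ε ≤ m / (96 * ρ * (1 + K) ^ 2) := hεB.trans ((min_le_right _ _).trans (min_le_left _ _))
  have hε8 : ε ≤ (1 - 2 * γ) * m / (960 * (1 + K) ^ 2 * η * (C₁ * δg)) :=
    hεB.trans ((min_le_right _ _).trans ((min_le_right _ _).trans (min_le_left _ _)))
  have hε9 : ε ≤ (1 - 2 * γ) * m ^ 2 / (160 * (C₁ * δg) * (B + 1)) :=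
    hεB.trans ((min_le_right _ _).trans ((min_le_right _ _).trans (min_le_right _ _)))
  have hg'δ : ∀ τ, |τ| ≤ δ → ‖g' τ‖ ≤ L * |τ| := fun τ hτ => hg' τ (hτ.trans hδg')
  have hparδ : ∀ τ, |τ| ≤ δ → V (z + τ • e + g τ) = φ τ • e := fun τ hτ => hpar τ (hτ.trans hδg')
  have hφsqδ : ∀ τ, |τ| ≤ δ → |φ τ| ≤ C₁' * τ ^ 2 := fun τ hτ =>
    (hφsq τ (hτ.trans hδg')).trans (mul_le_mul_of_nonneg_right hC₁C₁' (sq_nonneg _))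
  have hφlipδ : ∀ τ τ', |τ| ≤ δ → |τ'| ≤ δ → |φ τ - φ τ'| ≤ C₁' * δ * |τ - τ'| := fun τ τ' hτ hτ' => by
    rw [hC₁'δ]; exact hφlip τ τ' (hτ.trans hδg') (hτ'.trans hδg')
  have hlinδ : ∀ x ∈ closedBall z δ, ∀ y ∈ closedBall z δ, ‖(V x - V y) - A (x - y)‖ ≤ ρ * ‖x - y‖ :=
    fun x hx y hy => hlinρ x (closedBall_subset_closedBall hδρ' hx) y (closedBall_subset_closedBall hδρ' hy)
  have hηUδ : ∀ y ∈ closedBall z δ, 2 * ‖fderiv ℝ U y - fderiv ℝ U z‖ ≤ η :=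
    fun y hy => hηU y (closedBall_subset_closedBall hδη' hy)
  have hexpδ : ∀ y : EuclideanSpace ℝ (Fin 3), ‖y - z‖ ≤ δ → ∀ ζ : EuclideanSpace ℝ (Fin 3), ‖ζ‖ ≤ δ →
      Hb y + fderiv ℝ Hb y ζ + (1 / 2 * ((2 * γ - 1) * ⟪A ζ, ζ⟫) - (ν + Cν * ‖V y‖) * ‖ζ‖ ^ 2) ≤ Hb (y + ζ) :=
    fun y hy ζ hζ => hexpν y (hy.trans hδν') ζ (hζ.trans hδν')
  have hnode : ∀ x, ‖x - z‖ ≤ ε → Hb z - C₃ * ε ^ 2 ≤ Hb x := by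
    intro x hx
    have hxδ : ‖x - z‖ ≤ δ₁ := hx.trans (by linarith)
    have h1 := hnode₁ (x - z) hxδ
    rw [add_sub_cancel] at h1
    rw [← hHb, ← hV, ← hAdef] at h1
    have h2 : |⟪A (x - z), x - z⟫| ≤ ‖A‖ * ‖x - z‖ ^ 2 := by
      calc |⟪A (x - z), x - z⟫| ≤ ‖A (x - z)‖ * ‖x - z‖ := abs_real_inner_le_norm _ _
        _ ≤ ‖A‖ * ‖x - z‖ * ‖x - z‖ := mul_le_mul_of_nonneg_right (A.le_opNorm _) (norm_nonneg _)
        _ = ‖A‖ * ‖x - z‖ ^ 2 := by ring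
    have h3 : ‖x - z‖ ^ 2 ≤ ε ^ 2 := pow_le_pow_left₀ (norm_nonneg _) hx 2
    have h4 := (abs_le.1 h2).1
    have h5 : (1 - 2 * γ) * ⟪A (x - z), x - z⟫ ≤ (1 - 2 * γ) * (‖A‖ * ‖x - z‖ ^ 2) :=
      mul_le_mul_of_nonneg_left (abs_le.1 h2).2 h12.le
    have h6 : C₃ * ‖x - z‖ ^ 2 ≤ C₃ * ε ^ 2 := mul_le_mul_of_nonneg_left h3 hC₃0
    have e6 : C₃ = (1 - 2 * γ) * ‖A‖ / 2 + ν := rfl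
    rw [e6] at h6
    show Hb z - ((1 - 2 * γ) * ‖A‖ / 2 + ν) * ε ^ 2 ≤ Hb x
    linarith only [h1, h5, h6]
  have hρ1 : 18 * ρ ^ 2 / μ * (1 + K) ≤ μ / 16 := by
    have h1 : ρ ^ 2 ≤ (μ / (32 * (1 + K))) ^ 2 := pow_le_pow_left₀ hρpos.le hρμ 2
    rw [div_mul_eq_mul_div, div_le_iff₀ hμ]
    have e1 : 18 * (μ / (32 * (1 + K))) ^ 2 * (1 + K) = 18 * μ ^ 2 / (1024 * (1 + K)) := by field_simp; ring
    have h2 : 18 * μ ^ 2 / (1024 * (1 + K)) ≤ μ / 16 * μ := by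
      rw [div_le_iff₀ (by positivity)]; nlinarith only [hK2, sq_nonneg μ, mul_nonneg (sq_nonneg μ) hK0.le]
    have h1' := mul_le_mul_of_nonneg_left h1 (by positivity : (0:ℝ) ≤ 18 * (1 + K))
    linarith only [h1', e1, h2]
  have hρ2 : ρ ≤ μ / 2 := hρμ.trans (by rw [div_le_div_iff₀ (by positivity) (by norm_num)]; nlinarith only [hμ, hK1])
  have hν1 : ν ≤ (1 - 2 * γ) * μ / 64 := le_rfl
  have hrCν : Cν * C₁' * r ^ 2 ≤ (1 - 2 * γ) * μ / 64 := by
    have h1 : r ^ 2 ≤ r := by nlinarith only [hr3, hrpos]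
    have h2 : Cν * C₁' * r ≤ ν := by
      have := (le_div_iff₀ (by positivity : (0:ℝ) < Cν * C₁' + 1)).1 hr7
      linarith only [this, hrpos]
    calc Cν * C₁' * r ^ 2 ≤ Cν * C₁' * r := mul_le_mul_of_nonneg_left h1 (by positivity)
      _ ≤ (1 - 2 * γ) * μ / 64 := h2
  have hrθ : η * (1 + 2 * L * r) ≤ (1 - 2 * γ) / 2 := by
    have : η * (1 + 2 * L * r) ≤ (1 - 2 * γ) / 4 * (3 / 2) := mul_le_mul hη1 (by linarith) (by positivity) (by positivity)
    linarith
  have hεT : 3 * (1 - 2 * γ) * C₁' * ε / 2 + 3 * ρ ^ 2 * C₃ / μ ^ 2 ≤ (1 - 2 * γ) * μ / 32 * (18 * (1 + K)) := by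
    have h1 : 3 * (1 - 2 * γ) * C₁' * ε / 2 ≤ (1 - 2 * γ) * μ / 32 * (9 * (1 + K)) := by
      have := (le_div_iff₀ (by positivity : (0:ℝ) < 16 * C₁')).1 hε3
      nlinarith only [this, h12]
    have h2 : 3 * ρ ^ 2 * C₃ / μ ^ 2 ≤ (1 - 2 * γ) * μ / 32 * (9 * (1 + K)) := by
      have hρ2' : ρ ^ 2 ≤ ρ := by nlinarith only [hρle1, hρpos]
      have h3 : 3 * ρ ^ 2 * C₃ ≤ 3 * ρ * (C₃ + 1) := by nlinarith only [hC₃0, hρpos, hρ2']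
      have h4 := (le_div_iff₀ (by positivity : (0:ℝ) < 32 * (C₃ + 1))).1 hρb
      rw [div_le_iff₀ (by positivity)]
      linarith only [h3, h4]
    linarith
  have hrArc : 6 * ρ * (1 + K) * Real.sqrt (2 * κ) * C₁' * r ≤ μ / 16 := by
    have h1 : Real.sqrt (2 * κ) ≤ 2 := by
      rw [Real.sqrt_le_left (by norm_num)]; nlinarith only [hκle1, hκ0]
    have h2 : 6 * ρ * (1 + K) * Real.sqrt (2 * κ) * C₁' * r ≤ 6 * ρ * (1 + K) * 2 * C₁' * r := by
      have h1' := mul_le_mul_of_nonneg_left h1 (by positivity : (0:ℝ) ≤ 6 * ρ * (1 + K) * C₁' * r)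
      linarith only [h1']
    have h3 := (le_div_iff₀ (by positivity : (0:ℝ) < 192 * ρ * (1 + K) * C₁')).1 hr8
    linarith
  have hεArc : 6 * ρ * (1 + K) * Real.sqrt 2 * 3 * Real.sqrt (1 + K) * ε ≤ μ * r / 16 := by
    have h1 : 6 * ρ * (1 + K) * Real.sqrt 2 * 3 * Real.sqrt (1 + K) * ε ≤ 6 * ρ * (1 + K) * 2 * 3 * (1 + K) * ε := by
      have h0 := mul_le_mul hsq2 hsqK (Real.sqrt_nonneg _) (by norm_num)
      have h0' := mul_le_mul_of_nonneg_left h0 (by positivity : (0:ℝ) ≤ 18 * ρ * (1 + K) * ε)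
      linarith only [h0']
    have h2 := (le_div_iff₀ (by positivity : (0:ℝ) < 576 * ρ * (1 + K) ^ 2)).1 hε4
    linarith only [h1, h2]
  have hρ3 : ρ * Real.sqrt (2 * (1 + K)) * Real.sqrt κ ≤ 1 / 16 := by
    have h1 : ρ * Real.sqrt (2 * (1 + K)) * Real.sqrt κ ≤ ρ * (2 * (1 + K)) * 1 :=
      mul_le_mul (mul_le_mul_of_nonneg_left hsq2K hρpos.le) hsqκ (Real.sqrt_nonneg _) (by positivity)
    have h2 := (le_div_iff₀ (by positivity : (0:ℝ) < 32 * (1 + K))).1 hρ1'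
    linarith only [h1, h2]
  have hrBump : ((1 - 2 * γ) * α / 2 + ν + Cν * C₁' * r ^ 2) * (2 * (1 + K)) * κ +
      η * Real.sqrt (2 * (1 + K)) * Real.sqrt κ ≤ (1 - 2 * γ) / (160 * C₁' * δ) := by
    have hrhs : (1 - 2 * γ) / (160 * C₁' * δ) = τg := by rw [hτg, mul_assoc, hC₁'δ, ← mul_assoc]
    rw [hrhs]
    have hQ : (1 - 2 * γ) * α / 2 + ν + Cν * C₁' * r ^ 2 ≤ Q₀ := by rw [hQ₀]; linarith [hrCν]
    have h1 : ((1 - 2 * γ) * α / 2 + ν + Cν * C₁' * r ^ 2) * (2 * (1 + K)) * κ ≤ Q₀ * (2 * (1 + K)) * κ₁ := by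
      have := mul_le_mul (mul_le_mul_of_nonneg_right hQ (by positivity : (0:ℝ) ≤ 2 * (1 + K))) hκ1 hκ0 (by positivity)
      exact this
    have h2 : Q₀ * (2 * (1 + K)) * κ₁ ≤ τg / 2 := by
      have := (le_div_iff₀ (by positivity : (0:ℝ) < 4 * Q₀ * (1 + K))).1 hκ₁2
      linarith only [this]
    have h3 : η * Real.sqrt (2 * (1 + K)) * Real.sqrt κ ≤ η * (2 * (1 + K)) * 1 :=
      mul_le_mul (mul_le_mul_of_nonneg_left hsq2K hηpos.le) hsqκ (Real.sqrt_nonneg _) (by positivity)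
    have h4 := (le_div_iff₀ (by positivity : (0:ℝ) < 4 * (1 + K))).1 hη3
    linarith only [h1, h2, h3, h4]
  have hcapr : 2 * (1 + K) * κ * (C₁' * r ^ 2) ^ 2 ≤ r ^ 2 / 128 := by
    have h1 := (le_div_iff₀ (by positivity : (0:ℝ) < 16 * (1 + K) * C₁')).1 hr9
    have h6 : 2 * (1 + K) * C₁' * r ≤ 1 / 8 := by linarith only [h1]
    have h7 : C₁' * r ≤ 1 / 16 := by nlinarith only [h1, hK2, mul_nonneg hC₁'pos.le hrpos.le]
    have hA1 : 2 * (1 + K) * C₁' ^ 2 * r ^ 2 ≤ 1 / 128 := by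
      have := mul_le_mul h6 h7 (by positivity) (by norm_num)
      have e1 : 2 * (1 + K) * C₁' * r * (C₁' * r) = 2 * (1 + K) * C₁' ^ 2 * r ^ 2 := by ring
      linarith only [this, e1]
    have hA2 : 2 * (1 + K) * κ * (C₁' * r ^ 2) ^ 2 ≤ 2 * (1 + K) * C₁' ^ 2 * r ^ 2 * r ^ 2 := by
      have e1 : 2 * (1 + K) * κ * (C₁' * r ^ 2) ^ 2 = κ * (2 * (1 + K) * C₁' ^ 2 * r ^ 2 * r ^ 2) := by ring
      rw [e1]
      have : 0 ≤ 2 * (1 + K) * C₁' ^ 2 * r ^ 2 * r ^ 2 := by positivity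
      nlinarith only [hκle1, this]
    have hA3 := mul_le_mul_of_nonneg_right hA1 (sq_nonneg r)
    linarith only [hA2, hA3]
  have hcapε : 2 * (1 + K) * (9 * (1 + K) * ε ^ 2) ≤ r ^ 2 / 128 := by
    have h1 := (le_div_iff₀ (by positivity : (0:ℝ) < 48 * (1 + K))).1 hε5
    have h2 : (ε * (48 * (1 + K))) ^ 2 ≤ r ^ 2 := pow_le_pow_left₀ (by positivity) h1 2
    linarith only [h2]
  have hside : ∀ s : ℝ, s * s = 1 →
      (∀ τ ∈ Icc (r / 4) (r / 2), φ (s * τ) = 0) ∨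
      (∃ σ₀ ∈ Icc (r / 4) (r / 2), φ (s * σ₀) ≠ 0 ∧
        ε < Real.sqrt (|φ (s * σ₀)| / C₁') / 2 ∧
        ρ * (Real.sqrt (2 * (1 + K)) * (3 * Real.sqrt (1 + K)) * ε) ≤ |φ (s * σ₀)| / 16 ∧
        η * Real.sqrt (2 * (1 + K)) * (3 * Real.sqrt (1 + K)) * ε ≤ (1 - 2 * γ) * |φ (s * σ₀)| / (160 * C₁' * δ) ∧
        ((1 - 2 * γ) * α / 2 + ν + Cν * C₁' * r ^ 2) * (2 * (1 + K)) * (9 * (1 + K) * ε ^ 2) +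
          3 * (1 - 2 * γ) * C₁' * ε ^ 3 / 2 + 3 * ρ ^ 2 * C₃ * ε ^ 2 / μ ^ 2 ≤
          (1 - 2 * γ) * |φ (s * σ₀)| ^ 2 / (160 * C₁' * δ)) := by
    intro s hs
    rcases (hms s).2 with harc | ⟨σ₀, hσ₀, hne, hmseq⟩
    · exact Or.inl harc
    · right
      refine ⟨σ₀, hσ₀, hne, ?_, ?_, ?_, ?_⟩
      all_goals have hmm : m ≤ |φ (s * σ₀)| := by rw [hmseq]; exact hm_le s hs
      · -- `ε < √(|φ|/C₁')/2`
        have h1 : 2 * ε < Real.sqrt (|φ (s * σ₀)| / C₁') := by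
          rw [Real.lt_sqrt (by positivity), lt_div_iff₀ hC₁'pos]
          have h2 := (le_div_iff₀ (by positivity : (0:ℝ) < 8 * C₁')).1 hε6
          nlinarith only [h2, hεpos, hε2, hmm, hmpos]
        linarith
      · have hsq6 : Real.sqrt (2 * (1 + K)) * (3 * Real.sqrt (1 + K)) ≤ 6 * (1 + K) ^ 2 := by
          have := mul_le_mul hsq2K hsqK (Real.sqrt_nonneg _) (by positivity)
          linarith only [this]
        have h2 := (le_div_iff₀ (by positivity : (0:ℝ) < 96 * ρ * (1 + K) ^ 2)).1 hε7
        have h3 : ρ * (Real.sqrt (2 * (1 + K)) * (3 * Real.sqrt (1 + K)) * ε) ≤ ρ * (6 * (1 + K) ^ 2 * ε) :=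
          mul_le_mul_of_nonneg_left (mul_le_mul_of_nonneg_right hsq6 hεpos.le) hρpos.le
        linarith only [h2, h3, hmm]
      · have hsq6 : Real.sqrt (2 * (1 + K)) * (3 * Real.sqrt (1 + K)) ≤ 6 * (1 + K) ^ 2 := by
          have := mul_le_mul hsq2K hsqK (Real.sqrt_nonneg _) (by positivity)
          linarith only [this]
        rw [mul_assoc (160 : ℝ), hC₁'δ]
        have h2 := (le_div_iff₀ (by positivity : (0:ℝ) < 960 * (1 + K) ^ 2 * η * (C₁ * δg))).1 hε8
        have h3 : η * Real.sqrt (2 * (1 + K)) * (3 * Real.sqrt (1 + K)) * ε ≤ η * (6 * (1 + K) ^ 2) * ε := by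
          have := mul_le_mul_of_nonneg_left hsq6 hηpos.le
          exact mul_le_mul_of_nonneg_right (by linarith only [this]) hεpos.le
        have h3' := mul_le_mul_of_nonneg_right h3 (by positivity : (0:ℝ) ≤ 160 * (C₁ * δg))
        have hm' := mul_le_mul_of_nonneg_left hmm h12.le
        rw [le_div_iff₀ (by positivity)]
        linarith only [h3', h2, hm']
      · rw [mul_assoc (160 : ℝ), hC₁'δ]
        have h2 := (le_div_iff₀ (by positivity : (0:ℝ) < 160 * (C₁ * δg) * (B + 1))).1 hε9
        have hε21 : ε ^ 2 ≤ ε := by nlinarith only [hε2, hεpos]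
        have hε31 : ε ^ 3 ≤ ε := by nlinarith only [hε2, hεpos, hε21]
        have hL1 : ((1 - 2 * γ) * α / 2 + ν + Cν * C₁' * r ^ 2) * (2 * (1 + K)) * (9 * (1 + K) * ε ^ 2) +
            3 * (1 - 2 * γ) * C₁' * ε ^ 3 / 2 + 3 * ρ ^ 2 * C₃ * ε ^ 2 / μ ^ 2 ≤ B * ε := by
          rw [hB, hQ₁]
          have t1 : ((1 - 2 * γ) * α / 2 + ν + Cν * C₁' * r ^ 2) * (2 * (1 + K)) * (9 * (1 + K) * ε ^ 2) ≤
              ((1 - 2 * γ) * α / 2 + ν + Cν * C₁' * r ^ 2) * (18 * (1 + K) ^ 2) * ε := by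
            have e1 : ((1 - 2 * γ) * α / 2 + ν + Cν * C₁' * r ^ 2) * (2 * (1 + K)) * (9 * (1 + K) * ε ^ 2) =
                ((1 - 2 * γ) * α / 2 + ν + Cν * C₁' * r ^ 2) * (18 * (1 + K) ^ 2) * ε ^ 2 := by ring
            rw [e1]; exact mul_le_mul_of_nonneg_left hε21 (by positivity)
          have t2 : 3 * (1 - 2 * γ) * C₁' * ε ^ 3 / 2 ≤ 3 * (1 - 2 * γ) * C₁' / 2 * ε := by
            have := mul_le_mul_of_nonneg_left hε31 (by positivity : (0:ℝ) ≤ 3 * (1 - 2 * γ) * C₁' / 2)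
            rw [show 3 * (1 - 2 * γ) * C₁' * ε ^ 3 / 2 = 3 * (1 - 2 * γ) * C₁' / 2 * ε ^ 3 by ring]
            exact this
          have t3 : 3 * ρ ^ 2 * C₃ * ε ^ 2 / μ ^ 2 ≤ 3 * ρ ^ 2 * C₃ / μ ^ 2 * ε := by
            have := mul_le_mul_of_nonneg_left hε21 (by positivity : (0:ℝ) ≤ 3 * ρ ^ 2 * C₃ / μ ^ 2)
            rw [show 3 * ρ ^ 2 * C₃ * ε ^ 2 / μ ^ 2 = 3 * ρ ^ 2 * C₃ / μ ^ 2 * ε ^ 2 by ring]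
            exact this
          linarith
        have hm2 : m ^ 2 ≤ |φ (s * σ₀)| ^ 2 := pow_le_pow_left₀ hmpos.le hmm 2
        have hL1' := mul_le_mul_of_nonneg_right hL1 (by positivity : (0:ℝ) ≤ 160 * (C₁ * δg))
        have hpos' : 0 ≤ ε * (160 * (C₁ * δg)) := by positivity
        have hm2' := mul_le_mul_of_nonneg_left hm2 h12.le
        rw [le_div_iff₀ (by positivity)]
        linarith only [hL1', hpos', h2, hm2']
  have htrap := noExit_of_conditions h hγ hγ2 hfar hΩz hconf he1 hAe hb hμ hμα hαge hpos_i hneg_i hK hL hC₁'pos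
    hg0 hge hgd hg'δ hparδ hφc hφsqδ hφlipδ hρpos hηpos hνpos hCν hlinδ hηUδ hexpδ hrpos hrδ hεpos hε1 hC₃0 hnode
    hκ hρ1 hρ2 hν1 hrCν hrθ hLr hεT hrArc hεArc hρ3 hrBump hcapr hcapε hside
  have hOo : IsOpen {y : EuclideanSpace ℝ (Fin 3) | curl U y ≠ 0} := isOpen_vorticalSet h
  have hsub : ball z ε ∩ {y | curl U y ≠ 0} ⊆ {x : EuclideanSpace ℝ (Fin 3) |
      ∀ t, 0 ≤ t → lipschitzFlow hKlip x (-t) ∈ closedBall z δ₀} := by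
    rintro x ⟨hxball, hxO⟩ t ht
    have := htrap x hxO (mem_ball.1 hxball) t ht
    exact closedBall_subset_closedBall (by linarith) this
  have hne : (ball z ε ∩ {y | curl U y ≠ 0}).Nonempty :=
    (mem_closure_iff_nhds.1 hcl) _ (ball_mem_nhds z hεpos)
  obtain ⟨x, hx⟩ := hne
  have hxint : x ∈ interior {x : EuclideanSpace ℝ (Fin 3) |
      ∀ t, 0 ≤ t → lipschitzFlow hKlip x (-t) ∈ closedBall z δ₀} :=
    mem_interior.2 ⟨_, hsub, isOpen_ball.inter hOo, hx⟩
  rw [hthin] at hxint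
  exact hxint
end Summit.NavierStokesRegularity.NavierStokesRegularity.Theorems.PowerGaugeEulerLiouville.NodalContinuum
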